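import Summits.Ventures.HodgeRepro2.T5InertSelfDualHecke

/-!
# `U(H)` acts transitively on the self-dual lattices at an inert place
(cell pub-hodge-repro2, seat p3)

Tier-5 N3 support. The special case `Q₁ = 1` of files 182 / 184: when the standard lattice `𝒪_{E_v}³` is itself
self-dual for `H` (the Gram matrix `H` and its inverse have entries in `𝒪_{E_v}` — the record's situation in the
basis `e, e₀, f` with `H = antidiag(1, u, 1)`), every self-dual lattice `Q 𝒪³` of `(L_w³, H)` is `g · 𝒪³` for
some `g ∈ U(H)`, and the spherical Hecke algebra of the record's `K_v = U(H) ∩ GL₃(𝒪)` is isomorphic to that of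
any other self-dual lattice:
* `dualLattice_stdLattice_eq_self_of_integral` — `𝒪³` is self-dual when `H`, `H⁻¹` are integral (p8's T5-128);
* `isInteger_star_of_localConj` — the star `σ` preserves `𝒪_{E_v}` (p8's T5-125);
* **`exists_isometry_image_stdLattice_eq_std`** — transitivity of `U(H)` on the self-dual lattices;
* **`nonempty_heckeAlgebra_algEquiv_std`** — `H(U(Qᴴ H Q), K) ≃ₐ[k] H(U(H), K_H)`.

Mathlib + this seat's files 182 / 184 and their imports (seat p8's T5-128 / T5-137b / T5-142 / T5-155); no display;
no device. §8(d): uses an L-value-free non-vanishing device: NO.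
-/

namespace Summit.Ventures.HodgeRepro2.T5InertSelfDualStandard

open Matrix IsDedekindDomain IsDedekindDomain.HeightOneSpectrum NumberField Module
open Summit.Ventures.HodgeRepro2.T5IntegralUnits Summit.Ventures.HodgeRepro2.T5HermitianThreeElements
  Summit.Ventures.HodgeRepro2.T5UnitaryGroupIsometry Summit.Ventures.HodgeRepro2.T5StarOfInvolution
  Summit.Ventures.HodgeRepro2.T5InertSelfDualNormalForm Summit.Ventures.HodgeRepro2.T5InertSelfDualUnique
  Summit.Ventures.HodgeRepro2.T5InertSelfDualHecke Summit.Ventures.HodgeRepro2.T5UnitaryHeckeAdjoint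
  Summit.Ventures.HodgeRepro2.T5HeckePermutationModule

section General

variable {R E : Type*} [CommRing R] [Field E] [Algebra R E] [StarRing E]

/-- The standard lattice is self-dual for `H` when `H` and `H⁻¹` have integral entries — p8's T5-128
`dualLattice_stdLattice_eq_self` read with `Q = 1` (`1ᴴ * H * 1 = H`). -/
theorem dualLattice_stdLattice_eq_self_of_integral
    (hstar : ∀ x : E, IsLocalization.IsInteger R x → IsLocalization.IsInteger R (star x))
    {H : Matrix (Fin 3) (Fin 3) E} (hdet : IsUnit H.det)
    (hint : ∀ i j, IsLocalization.IsInteger R (H i j))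
    (hinv : ∀ i j, IsLocalization.IsInteger R (H⁻¹ i j)) :
    dualLattice R ((1 : Matrix (Fin 3) (Fin 3) E).conjTranspose * H * 1) (stdLattice R) = stdLattice R := by
  rw [Matrix.conjTranspose_one, Matrix.one_mul, Matrix.mul_one]
  exact dualLattice_stdLattice_eq_self hstar (Matrix.mul_nonsing_inv H hdet) hint hinv

end General

section Local

variable {K : Type*} [Field K] [NumberField K] (v : HeightOneSpectrum (𝓞 K))
variable {L : Type*} [Field L] [NumberField L] [Algebra K L]
variable (w : HeightOneSpectrum (𝓞 L)) [w.asIdeal.LiesOver v.asIdeal]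

/-- The star `starRingOfQuadratic h2 σ hσ` (= `σ`, p8's `star_eq`) preserves `𝒪_{E_v}` (p8's T5-125
`map_mem_integralClosure`). -/
theorem isInteger_star_of_localConj (h2 : finrank (v.adicCompletion K) (w.adicCompletion L) = 2)
    (σ : w.adicCompletion L ≃ₐ[v.adicCompletion K] w.adicCompletion L) (hσ : σ ≠ 1)
    (x : w.adicCompletion L)
    (hx : IsLocalization.IsInteger (integralClosure (v.adicCompletionIntegers K) (w.adicCompletion L)) x) :
    letI := starRingOfQuadratic h2 σ hσ
    IsLocalization.IsInteger (integralClosure (v.adicCompletionIntegers K) (w.adicCompletion L)) (star x) := by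
  letI := starRingOfQuadratic h2 σ hσ
  rw [star_eq σ.toRingEquiv _ x]
  exact (isInteger_integralClosure_iff _).2 (map_mem_integralClosure σ ((isInteger_integralClosure_iff _).1 hx))

/-- **`U(H)` acts transitively on the self-dual lattices.** Under the hypotheses of file 182, if `H` and `H⁻¹`
have entries in `𝒪_{E_v}` (so that `𝒪³` is self-dual), every self-dual lattice `Q 𝒪³` is `g · 𝒪³` for some
`g` with `gᴴ H g = H`. -/
theorem exists_isometry_image_stdLattice_eq_std
    (h2 : finrank (v.adicCompletion K) (w.adicCompletion L) = 2)
    {ϖ : v.adicCompletionIntegers K} (hϖ : Irreducible ϖ)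
    (hinert : Irreducible (algebraMap (v.adicCompletionIntegers K) (w.adicCompletionIntegers L) ϖ))
    (σ : w.adicCompletion L ≃ₐ[v.adicCompletion K] w.adicCompletion L) (hσ : σ ≠ 1)
    {H : Matrix (Fin 3) (Fin 3) (w.adicCompletion L)}
    (hH : letI := starRingOfQuadratic h2 σ hσ; H.IsHermitian) (hdet : IsUnit H.det)
    (hint : ∀ i j, IsLocalization.IsInteger
      (integralClosure (v.adicCompletionIntegers K) (w.adicCompletion L)) (H i j))
    (hinv : ∀ i j, IsLocalization.IsInteger
      (integralClosure (v.adicCompletionIntegers K) (w.adicCompletion L)) (H⁻¹ i j))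
    {Q : Matrix (Fin 3) (Fin 3) (w.adicCompletion L)} (hQ : IsUnit Q)
    (hself : letI := starRingOfQuadratic h2 σ hσ
      dualLattice (integralClosure (v.adicCompletionIntegers K) (w.adicCompletion L))
        (Q.conjTranspose * H * Q)
        (stdLattice (integralClosure (v.adicCompletionIntegers K) (w.adicCompletion L))) =
      stdLattice (integralClosure (v.adicCompletionIntegers K) (w.adicCompletion L))) :
    letI := starRingOfQuadratic h2 σ hσ
    ∃ g : Matrix (Fin 3) (Fin 3) (w.adicCompletion L), g.conjTranspose * H * g = H ∧
      (fun x => g *ᵥ x) '' stdLattice (integralClosure (v.adicCompletionIntegers K) (w.adicCompletion L)) =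
        (fun x => Q *ᵥ x) ''
          stdLattice (integralClosure (v.adicCompletionIntegers K) (w.adicCompletion L)) := by
  letI := starRingOfQuadratic h2 σ hσ
  obtain ⟨g, hg, himg⟩ := exists_isometry_image_stdLattice_eq v w h2 hϖ hinert σ hσ hH hdet hQ isUnit_one
    hself (dualLattice_stdLattice_eq_self_of_integral
      (R := integralClosure (v.adicCompletionIntegers K) (w.adicCompletion L))
      (isInteger_star_of_localConj v w h2 σ hσ) hdet hint hinv)
  refine ⟨g, hg, ?_⟩
  simpa only [Matrix.one_mulVec, Set.image_id'] using himg

/-- **The spherical Hecke algebra of the record's `K_v`** (`H`, `H⁻¹` integral: `K_H` = the stabiliser of `𝒪³`)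
**is isomorphic to that of any other self-dual lattice** `Q 𝒪³`. -/
theorem nonempty_heckeAlgebra_algEquiv_std (k : Type*) [Field k]
    (h2 : finrank (v.adicCompletion K) (w.adicCompletion L) = 2)
    {ϖ : v.adicCompletionIntegers K} (hϖ : Irreducible ϖ)
    (hinert : Irreducible (algebraMap (v.adicCompletionIntegers K) (w.adicCompletionIntegers L) ϖ))
    (σ : w.adicCompletion L ≃ₐ[v.adicCompletion K] w.adicCompletion L) (hσ : σ ≠ 1)
    {H : Matrix (Fin 3) (Fin 3) (w.adicCompletion L)}
    (hH : letI := starRingOfQuadratic h2 σ hσ; H.IsHermitian) (hdet : IsUnit H.det)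
    (hint : ∀ i j, IsLocalization.IsInteger
      (integralClosure (v.adicCompletionIntegers K) (w.adicCompletion L)) (H i j))
    (hinv : ∀ i j, IsLocalization.IsInteger
      (integralClosure (v.adicCompletionIntegers K) (w.adicCompletion L)) (H⁻¹ i j))
    {Q : Matrix (Fin 3) (Fin 3) (w.adicCompletion L)} (hQ : IsUnit Q)
    (hself : letI := starRingOfQuadratic h2 σ hσ
      dualLattice (integralClosure (v.adicCompletionIntegers K) (w.adicCompletion L))
        (Q.conjTranspose * H * Q)
        (stdLattice (integralClosure (v.adicCompletionIntegers K) (w.adicCompletion L))) =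
      stdLattice (integralClosure (v.adicCompletionIntegers K) (w.adicCompletion L))) :
    letI := starRingOfQuadratic h2 σ hσ
    Nonempty
      (heckeAlgebra k (hyperspecialSubgroup (integralClosure (v.adicCompletionIntegers K) (w.adicCompletion L))
          (Q.conjTranspose * H * Q)) ≃ₐ[k]
        heckeAlgebra k
          (hyperspecialSubgroup (integralClosure (v.adicCompletionIntegers K) (w.adicCompletion L)) H)) := by
  letI := starRingOfQuadratic h2 σ hσ
  -- `𝒪_{E_v}` has fraction field `L_w` (Mathlib, `[L_w : K_v]` finite)
  haveI : IsFractionRing (integralClosure (v.adicCompletionIntegers K) (w.adicCompletion L))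
      (w.adicCompletion L) :=
    integralClosure.isFractionRing_of_finite_extension (v.adicCompletion K) (w.adicCompletion L)
  have hQdet : IsUnit Q.det := (Matrix.isUnit_iff_isUnit_det Q).1 hQ
  set G₂ : Matrix (Fin 3) (Fin 3) (w.adicCompletion L) := Q.conjTranspose * H * Q with hG₂
  have hG₂h : G₂.IsHermitian := Matrix.isHermitian_conjTranspose_mul_mul Q hH
  have hdet₂ : IsUnit G₂.det := by
    rw [hG₂, Matrix.det_mul, Matrix.det_mul, Matrix.det_conjTranspose]
    exact ((isUnit_star.mpr hQdet).mul hdet).mul hQdet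
  -- `H` and `Qᴴ H Q` are both integrally congruent to `antidiag(1, 1, 1)`, hence to each other
  obtain ⟨P₁, hP₁, hP₁det, hPHP₁⟩ :=
    exists_congruent_J3_one_adicCompletion v w h2 hϖ hinert σ hσ hH hint hdet hinv
  obtain ⟨P₂, hP₂, hP₂det, hPHP₂⟩ :=
    exists_congruent_J3_one_of_dualLattice_eq v w h2 hϖ hinert σ hσ hG₂h hdet₂ hself
  obtain ⟨M, hM, hMdet, hG⟩ := exists_congruent_integral_of_J3_one hP₁ hP₁det hPHP₁ hP₂ hP₂det hPHP₂
  exact nonempty_heckeAlgebra_algEquiv_of_congruent_integral k hM hMdet hG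

end Local

end Summit.Ventures.HodgeRepro2.T5InertSelfDualStandard
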